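/-
Copyright (c) 2026. All rights reserved.
Released under Apache 2.0 license as described in the file LICENSE.
Authors: abc-iut cell, wave-4 seat abc-iut-w4-d059 (proof-only; piece (P-A′-Q) of the (AI4″) producer: the
stabiliser in a compact completion is the image of the stabiliser in the dense subgroup, from a LEVELWISE
dictionary, density, compactness and cofinality of the level kernels).
-/
import Literature.AnabelianGeometry.SemiGraphs.TemperedBranchPairProfinite
import Mathlib.Algebra.Group.End
import Mathlib.Tactic.Group
import HarnessLib

/-!
# [SemiAnbd] Thm 3.7 (iii) p. 41, Comments (6)(b): stabilisers in the completion from levelwise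
# stabilisers (proof-only)

Mochizuki, *Semi-graphs of anabelioids*, Publ. RIMS **42** (2006), proof of Thm 3.7 (iii) p. 41 with the
author's Comments (6)(b) (identifications "in the profinite topology") and Thm 5.4 (i) p. 66; the topological
step is the one of abc-iut-L3-t11's `iInter_mul_coe_eq_of_isCompact` ("`⋂_i K·N_i = K`").
[cite: MochizukiSemiAnbd2006, Thm 3.7(iii) p.41]

PROOF-ONLY, GENERIC file (abc-iut cell, sub-DAG `plan/L3/SUBDAG-SemiAnbd-Thm54.md`, producer row T54-B,
piece (P-A′-Q) of the (AI4″) producer, seat abc-iut-w4-d059): `Q` a compact Hausdorff group receiving `E`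
with DENSE image `ιQ`, acting on levels `X_j` by `φ_j : Q →* Function.End (X_j)` with open, antitone
kernels whose intersection is trivial (cofinality); `V ≤ E` with compact image.  If, at EVERY level, the
`E`-stabiliser of `s_j` (for the restricted action `φ_j ∘ ιQ`) is `V` times the level kernel
(`hE`: "`e` fixes `s_j` ⇒ `v⁻¹ e` acts trivially at level `j` for some `v ∈ V`"; `hV`: `V` fixes every
`s_j`), then the full `Q`-stabiliser of the system `s` is EXACTLY `ιQ(V)`
(`forall_apply_eq_iff_mem_map`) — the `Q`-dictionary hypotheses `hω_dict` / `hκ_dict` of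
`map_aug_le_conj_of_stabilizer` (ArithBranchPairOrbit) reduced to finite-level `E`-statements.
No definition; nothing specific to anabelioids; nothing here takes a side on [IUTchIII] Cor. 3.12.
-/

namespace Literature.AnabelianGeometry.SemiGraphs

namespace CompactOrbit

open scoped Pointwise

universe v u u' w

/-- **The stabiliser in the compact completion is the image of the stabiliser in the dense subgroup**:
see the module docstring.  (`q` fixes `s_j`; the open coset `q · ker φ_j` contains some `ιQ e`, which then
fixes `s_j`, so `ιQ e ∈ ιQ(V) · ker φ_j` by the level-`j` dictionary, whence `q ∈ ιQ(V) · ker φ_j` for every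
`j`; and `⋂_j ιQ(V) · ker φ_j = ιQ(V)` for `ιQ(V)` compact and the kernels open, directed, with trivial
intersection.) [cite: MochizukiSemiAnbd2006, Thm 3.7(iii) p.41] -/
theorem forall_apply_eq_iff_mem_map {Q : Type u} [Group Q] [TopologicalSpace Q] [IsTopologicalGroup Q]
    [T2Space Q] {E : Type u'} [Group E] (ιQ : E →* Q) (hdense : DenseRange ιQ)
    {J : Type v} [Preorder J] [IsDirectedOrder J] [Nonempty J]
    {X : J → Type w} (φ : ∀ j, Q →* Function.End (X j)) (hker : ∀ j, IsOpen ((φ j).ker : Set Q))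
    (hanti : ∀ ⦃i j : J⦄, i ≤ j → (φ j).ker ≤ (φ i).ker)
    (hbot : ∀ q : Q, (∀ j, q ∈ (φ j).ker) → q = 1)
    (V : Subgroup E) (hVc : IsCompact ((V.map ιQ : Subgroup Q) : Set Q))
    (s : ∀ j, X j)
    (hE : ∀ (j : J) (e : E), φ j (ιQ e) (s j) = s j → ∃ v ∈ V, ιQ (v⁻¹ * e) ∈ (φ j).ker)
    (hV : ∀ v ∈ V, ∀ j, φ j (ιQ v) (s j) = s j) (q : Q) :
    (∀ j, φ j q (s j) = s j) ↔ q ∈ V.map ιQ := by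
  constructor
  · intro hq
    -- `q ∈ ιQ(V) · ker φ_j` for every `j`
    have hmem : ∀ j, q ∈ ((V.map ιQ : Subgroup Q) : Set Q) * ((φ j).ker : Set Q) := by
      intro j
      -- the open coset `q · ker φ_j` meets the dense range
      have hopen : IsOpen {y : Q | q⁻¹ * y ∈ (φ j).ker} :=
        (hker j).preimage (continuous_const.mul continuous_id)
      obtain ⟨e, he⟩ := hdense.exists_mem_open hopen
        ⟨q, show q⁻¹ * q ∈ (φ j).ker by rw [inv_mul_cancel]; exact (φ j).ker.one_mem⟩
      -- `ιQ e` fixes `s_j`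
      have hn : φ j (q⁻¹ * ιQ e) = 1 := he
      have hfix : φ j (ιQ e) (s j) = s j := by
        have h1 : ιQ e = q * (q⁻¹ * ιQ e) := (mul_inv_cancel_left q (ιQ e)).symm
        rw [h1, map_mul, hn, mul_one, hq j]
      obtain ⟨v, hv, hve⟩ := hE j e hfix
      -- `q = ιQ v · (ιQ(v⁻¹ e) · (q⁻¹ ιQ e)⁻¹)`
      refine Set.mem_mul.mpr ⟨ιQ v, ⟨v, hv, rfl⟩, ιQ (v⁻¹ * e) * (q⁻¹ * ιQ e)⁻¹,
        (φ j).ker.mul_mem hve ((φ j).ker.inv_mem hn), ?_⟩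
      rw [map_mul, map_inv]
      group
    -- `⋂_j ιQ(V) · ker φ_j = ιQ(V)`
    have hdir : ∀ i j : J, ∃ k, (φ k).ker ≤ (φ i).ker ∧ (φ k).ker ≤ (φ j).ker := by
      intro i j
      obtain ⟨k, hik, hjk⟩ := exists_ge_ge i j
      exact ⟨k, hanti hik, hanti hjk⟩
    have := iInter_mul_coe_eq_of_isCompact (fun j => (φ j).ker) hker hdir hbot hVc
    have hq' : q ∈ ⋂ j, ((V.map ιQ : Subgroup Q) : Set Q) * ((φ j).ker : Set Q) := Set.mem_iInter.mpr hmem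
    rw [this] at hq'
    exact hq'
  · rintro ⟨v, hv, rfl⟩
    exact hV v hv

end CompactOrbit

end Literature.AnabelianGeometry.SemiGraphs
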